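import Summits.CriticalPhenomena.Ising3DConformalLimit.Theorems.PrecisionLaplacianEtaBoundsTransferFourier

/-!
# Pick inversion, auxiliary file 13: the de la Vallée-Poussin kernel `(1 + cos t)^N` and
# localisation of Brillouin-zone integrals at a point of continuity (two transverse dimensions)

Helper file for stub `stub_pickInversion` of line `self-energy-pick-inversion`, crux
`PrecisionLaplacian.DirectCorrelationStableTail` (stmt-CriticalPhenomena-4799). Pure theorem file.

With `I_N = ∫_{-π}^{π} (1 + cos t)^N dt`:
* `vp_integral_ge` : `I_N ≥ 2s(1 + cos s)^N` (`0 < s ≤ π`), in particular `I_N > 0`;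
* `tendsto_vp_far_sup` : `(1 + cos δ)^N 2^N/I_N² → 0` for `cos δ < 1` (the sup of the product kernel
  `∏_j (1 + cos u_j)^N/I_N²` off a `δ`-box around the origin in two dimensions);
* `tendsto_setIntegral_vp_kernel` (registered sub-goal `stub_pickInversion_auxLocalisation`): for
  `h` integrable on `[-π,π]²` and continuous at `k₀ ∈ (-π,π)²`,
  `∫_{[-π,π]²} h(k) ∏_j (1 + cos(k_j - k₀_j))^N dk / I_N² → h(k₀)` (no periodic shift is needed: off
  the `δ`-box around `k₀` some coordinate difference is `δ`-far from `2πℤ`).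
-/

noncomputable section

namespace Summit.CriticalPhenomena.Ising3DConformalLimit.Cruxes.DirectCorrelationStableTail.SelfEnergyPickInversion

open Filter Topology Finset Real MeasureTheory
open scoped BigOperators
open Summit.CriticalPhenomena.Ising3DConformalLimit.Theorems.EtaBoundsTransfer
  (integrableOn_cube_of_continuous volume_cube_lt_top)

/-! ### The one-dimensional kernel `(1 + cos t)^N` -/

/-- `I_N ≥ 2s(1 + cos s)^N` for `0 < s ≤ π` (restrict to `[-s, s]`, where `cos t ≥ cos s`).
[folklore] -/
theorem vp_integral_ge (N : ℕ) {s : ℝ} (hs0 : 0 < s) (hsπ : s ≤ π) :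
    2 * s * (1 + Real.cos s) ^ N ≤ ∫ t in (-π)..π, (1 + Real.cos t) ^ N := by
  have hπ := Real.pi_pos
  have hnn : ∀ t, 0 ≤ (1 + Real.cos t) ^ N := fun t => pow_nonneg (by linarith [Real.neg_one_le_cos t]) N
  have hint : ∀ a b, IntervalIntegrable (fun t => (1 + Real.cos t) ^ N) volume a b :=
    fun a b => Continuous.intervalIntegrable (by fun_prop) _ _
  calc 2 * s * (1 + Real.cos s) ^ N = ∫ t in (-s)..s, (1 + Real.cos s) ^ N := by
        rw [intervalIntegral.integral_const, smul_eq_mul]; ring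
    _ ≤ ∫ t in (-s)..s, (1 + Real.cos t) ^ N := by
        refine intervalIntegral.integral_mono_on (by linarith) intervalIntegrable_const (hint _ _) fun t ht => ?_
        refine pow_le_pow_left₀ (by linarith [Real.neg_one_le_cos s]) ?_ N
        have : Real.cos s ≤ Real.cos t := by
          rw [← Real.cos_abs t]
          exact Real.cos_le_cos_of_nonneg_of_le_pi (abs_nonneg t) hsπ (abs_le.2 ⟨ht.1, ht.2⟩)
        linarith
    _ ≤ ∫ t in (-π)..π, (1 + Real.cos t) ^ N :=
        intervalIntegral.integral_mono_interval (by linarith) (by linarith) (by linarith)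
          (Eventually.of_forall hnn) (hint _ _)

/-- `I_N > 0`. [folklore] -/
theorem vp_integral_pos (N : ℕ) : 0 < ∫ t in (-π)..π, (1 + Real.cos t) ^ N := by
  have h2 := vp_integral_ge N (s := π / 2) (by positivity) (by linarith [Real.pi_pos])
  rw [Real.cos_pi_div_two] at h2
  have : 0 < 2 * (π / 2) * (1 + 0 : ℝ) ^ N := by simp [Real.pi_pos]
  linarith

/-- **Off-peak decay of the product kernel**: `(1 + cos δ)^N 2^N/I_N² → 0` when `cos δ < 1`.
[folklore] -/
theorem tendsto_vp_far_sup {δ : ℝ} (hδ : Real.cos δ < 1) :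
    Tendsto (fun N : ℕ => (1 + Real.cos δ) ^ N * 2 ^ N / (∫ t in (-π)..π, (1 + Real.cos t) ^ N) ^ 2)
      atTop (𝓝 0) := by
  have hπ := Real.pi_pos
  have hcδ : 0 ≤ 1 + Real.cos δ := by linarith [Real.neg_one_le_cos δ]
  -- the comparison ratio `ρ = (3 + cos δ)/4 < 1`
  set ρ : ℝ := (3 + Real.cos δ) / 4 with hρ
  have hρ0 : 0 < ρ := by rw [hρ]; linarith [Real.neg_one_le_cos δ]
  have hρ1 : ρ < 1 := by rw [hρ]; linarith
  -- `s_N = 1/√(N+1)`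
  set s : ℕ → ℝ := fun N => 1 / Real.sqrt ((N : ℝ) + 1) with hs
  have hs_pos : ∀ N, 0 < s N := fun N => by simp only [hs]; positivity
  have hs_le : ∀ N, s N ≤ 1 := fun N => by
    simp only [hs]
    rw [div_le_one (by positivity)]
    exact Real.one_le_sqrt.2 (by linarith [(Nat.cast_nonneg N : (0 : ℝ) ≤ N)])
  have hs_sq : ∀ N, s N ^ 2 = 1 / ((N : ℝ) + 1) := fun N => by
    simp only [hs]; rw [div_pow, one_pow, Real.sq_sqrt (by positivity)]
  have hs_lim : Tendsto s atTop (𝓝 0) := by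
    simp only [hs]
    have h1 : Tendsto (fun N : ℕ => Real.sqrt ((N : ℝ) + 1)) atTop atTop :=
      Real.tendsto_sqrt_atTop.comp (tendsto_atTop_add_const_right _ _ tendsto_natCast_atTop_atTop)
    exact tendsto_const_nhds.div_atTop h1
  -- eventually `(1 + cos s_N)² ≥ 2(1 + cos δ)/ρ`
  have hcos_lim : Tendsto (fun N => (1 + Real.cos (s N)) ^ 2) atTop (𝓝 4) := by
    have := ((Real.continuous_cos.tendsto 0).comp hs_lim)
    rw [Real.cos_zero] at this
    have h2 := ((tendsto_const_nhds (x := (1 : ℝ))).add this).pow 2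
    norm_num at h2
    exact h2
  have hkey : 2 * (1 + Real.cos δ) / ρ < 4 := by
    rw [div_lt_iff₀ hρ0, hρ]; linarith
  have hev : ∀ᶠ N in atTop, 2 * (1 + Real.cos δ) / ρ ≤ (1 + Real.cos (s N)) ^ 2 :=
    (hcos_lim.eventually (eventually_ge_nhds hkey)).mono fun N h => h
  -- the bound `(N+1) ρ^N / 4`
  have hbound : ∀ᶠ N : ℕ in atTop,
      (1 + Real.cos δ) ^ N * 2 ^ N / (∫ t in (-π)..π, (1 + Real.cos t) ^ N) ^ 2 ≤ ((N : ℝ) + 1) / 4 * ρ ^ N := by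
    filter_upwards [hev] with N hN
    have hI := vp_integral_ge N (hs_pos N) ((hs_le N).trans (by linarith [Real.pi_gt_three]))
    have hc : 0 < 1 + Real.cos (s N) := by
      have : Real.cos 1 ≤ Real.cos (s N) :=
        Real.cos_le_cos_of_nonneg_of_le_pi (hs_pos N).le (by linarith [Real.pi_gt_three]) (hs_le N)
      linarith [Real.cos_one_pos]
    have hI0 : 0 < 2 * s N * (1 + Real.cos (s N)) ^ N := by
      have := hs_pos N; positivity
    calc (1 + Real.cos δ) ^ N * 2 ^ N / (∫ t in (-π)..π, (1 + Real.cos t) ^ N) ^ 2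
        ≤ (1 + Real.cos δ) ^ N * 2 ^ N / (2 * s N * (1 + Real.cos (s N)) ^ N) ^ 2 := by
          apply div_le_div_of_nonneg_left (by positivity) (by positivity)
          exact pow_le_pow_left₀ hI0.le hI 2
      _ = ((N : ℝ) + 1) / 4 * ((2 * (1 + Real.cos δ)) / (1 + Real.cos (s N)) ^ 2) ^ N := by
          have hsN : s N ^ 2 = 1 / ((N : ℝ) + 1) := hs_sq N
          have hc2 : ((1 + Real.cos (s N)) ^ 2) ^ N = ((1 + Real.cos (s N)) ^ N) ^ 2 := by
            rw [← pow_mul, ← pow_mul, mul_comm]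
          have e1 : (2 * s N * (1 + Real.cos (s N)) ^ N) ^ 2 =
              4 / ((N : ℝ) + 1) * ((1 + Real.cos (s N)) ^ N) ^ 2 := by
            rw [mul_pow, mul_pow, hsN]; ring
          rw [e1, div_pow, hc2, mul_pow]
          field_simp
      _ ≤ ((N : ℝ) + 1) / 4 * ρ ^ N := by
          refine mul_le_mul_of_nonneg_left (pow_le_pow_left₀ (by positivity) ?_ N) (by positivity)
          rw [div_le_iff₀ (by positivity)]
          have := (div_le_iff₀ hρ0).1 hN
          linarith
  -- conclusion by squeezing
  have hlim : Tendsto (fun N : ℕ => ((N : ℝ) + 1) / 4 * ρ ^ N) atTop (𝓝 0) := by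
    have h1 := tendsto_self_mul_const_pow_of_lt_one hρ0.le hρ1
    have h2 := tendsto_pow_atTop_nhds_zero_of_lt_one hρ0.le hρ1
    have : (fun N : ℕ => ((N : ℝ) + 1) / 4 * ρ ^ N) = fun N : ℕ => (1 / 4) * ((N : ℝ) * ρ ^ N) + (1 / 4) * ρ ^ N := by
      funext N; ring
    rw [this]
    have h3 := (h1.const_mul (1 / 4)).add (h2.const_mul (1 / 4))
    rw [mul_zero, add_zero] at h3
    exact h3
  refine tendsto_of_tendsto_of_tendsto_of_le_of_le' tendsto_const_nhds hlim ?_ hbound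
  exact Eventually.of_forall fun N => by positivity

/-! ### Localisation at a point of continuity -/

/-- Points of the cube that are `δ`-far from `k₀ ∈ (-π,π)²` in one coordinate have a small kernel:
`(1 + cos (k_j - k₀_j)) ≤ 1 + cos δ` if `δ ≤ |k_j - k₀_j|`, `|k_j| ≤ π` and `δ ≤ π - |k₀_j|`.
[folklore] -/
theorem one_add_cos_sub_le {t c δ : ℝ} (hδ0 : 0 ≤ δ) (ht : |t| ≤ π) (hc : δ ≤ π - |c|)
    (hfar : δ ≤ |t - c|) : 1 + Real.cos (t - c) ≤ 1 + Real.cos δ := by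
  have hπ := Real.pi_pos
  have h2 : |t - c| ≤ 2 * π - δ := by
    have : |t - c| ≤ |t| + |c| := abs_sub _ _
    linarith [abs_nonneg c]
  rw [← Real.cos_abs (t - c)]
  rcases le_or_gt |t - c| π with h | h
  · linarith [Real.cos_le_cos_of_nonneg_of_le_pi hδ0 h hfar]
  · -- `|t - c| ∈ (π, 2π - δ]`: use `cos x = cos (2π - x)`
    have h3 : Real.cos |t - c| = Real.cos (2 * π - |t - c|) := by
      rw [Real.cos_two_pi_sub]
    rw [h3]
    linarith [Real.cos_le_cos_of_nonneg_of_le_pi hδ0 (by linarith) (by linarith : δ ≤ 2 * π - |t - c|)]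

/-- The product kernel integrates to `I_N²` over the cube, whatever the centre. [folklore] -/
theorem setIntegral_vp_prod (N : ℕ) (k₀ : Fin 2 → ℝ) :
    ∫ k in Set.pi Set.univ (fun _ : Fin 2 => Set.Icc (-π) π), ∏ j, (1 + Real.cos (k j - k₀ j)) ^ N =
      (∫ t in (-π)..π, (1 + Real.cos t) ^ N) ^ 2 := by
  have hπ := Real.pi_pos
  rw [MeasureTheory.volume_pi, MeasureTheory.Measure.restrict_pi_pi,
    MeasureTheory.integral_fintype_prod_eq_prod (fun (j : Fin 2) (t : ℝ) => (1 + Real.cos (t - k₀ j)) ^ N)]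
  have h1 : ∀ j : Fin 2, ∫ t, (1 + Real.cos (t - k₀ j)) ^ N ∂((volume : Measure ℝ).restrict (Set.Icc (-π) π))
      = ∫ t in (-π)..π, (1 + Real.cos t) ^ N := by
    intro j
    rw [integral_Icc_eq_integral_Ioc, ← intervalIntegral.integral_of_le (by linarith)]
    have hper : Function.Periodic (fun t => (1 + Real.cos t) ^ N) (2 * π) := fun t => by
      simp [Real.cos_add_two_pi]
    have h2 := intervalIntegral.integral_comp_sub_right (fun t => (1 + Real.cos t) ^ N) (k₀ j) (a := -π) (b := π)
    rw [h2]
    have h3 := hper.intervalIntegral_add_eq (-π - k₀ j) (-π)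
    rw [show -π - k₀ j + 2 * π = π - k₀ j by ring, show -π + 2 * π = π by ring] at h3
    exact h3
  simp_rw [h1]
  rw [Fin.prod_univ_two, sq]

/-- **Localisation at a point of continuity.** Let `h` be integrable on `[-π,π]²` and continuous at
`k₀ ∈ (-π,π)²`. Then `∫_{[-π,π]²} h(k) ∏_j (1 + cos(k_j - k₀_j))^N dk / I_N² → h(k₀)`. [folklore] -/
theorem tendsto_setIntegral_vp_kernel {h : (Fin 2 → ℝ) → ℝ}
    (hint : IntegrableOn h (Set.pi Set.univ (fun _ : Fin 2 => Set.Icc (-π) π)) volume)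
    {k₀ : Fin 2 → ℝ} (hk₀ : ∀ j, |k₀ j| < π) (hcont : ContinuousAt h k₀) :
    Tendsto (fun N : ℕ => (∫ k in Set.pi Set.univ (fun _ : Fin 2 => Set.Icc (-π) π),
        h k * ∏ j, (1 + Real.cos (k j - k₀ j)) ^ N) / (∫ t in (-π)..π, (1 + Real.cos t) ^ N) ^ 2)
      atTop (𝓝 (h k₀)) := by
  have hπ := Real.pi_pos
  set K := Set.pi Set.univ (fun _ : Fin 2 => Set.Icc (-π) π) with hK
  set μ : Measure (Fin 2 → ℝ) := volume.restrict K with hμ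
  haveI : IsFiniteMeasure μ := ⟨by rw [hμ, Measure.restrict_apply_univ]; exact volume_cube_lt_top⟩
  have hKm : MeasurableSet K := MeasurableSet.univ_pi fun _ => measurableSet_Icc
  -- margins: `δ₁ = π - max |k₀ j| > 0`
  have hmargin : 0 < π - max |k₀ 0| |k₀ 1| := by
    have := hk₀ 0; have := hk₀ 1
    rcases le_total |k₀ 0| |k₀ 1| with h | h
    · rw [max_eq_right h]; linarith
    · rw [max_eq_left h]; linarith
  rw [Metric.tendsto_atTop]
  intro ε hε
  -- continuity at `k₀`
  obtain ⟨δ₀, hδ₀, hδ₀h⟩ := Metric.continuousAt_iff.mp hcont (ε / 2) (by positivity)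
  set δ : ℝ := min δ₀ (π - max |k₀ 0| |k₀ 1|) with hδdef
  have hδpos : 0 < δ := lt_min hδ₀ hmargin
  have hmax : ∀ j : Fin 2, |k₀ j| ≤ max |k₀ 0| |k₀ 1| := by
    intro j; fin_cases j
    · exact le_max_left _ _
    · exact le_max_right _ _
  have hδle : ∀ j : Fin 2, δ ≤ π - |k₀ j| := fun j => by
    linarith [hmax j, min_le_right δ₀ (π - max |k₀ 0| |k₀ 1|)]
  have hcδ' : 0 ≤ 1 + Real.cos δ := by linarith [Real.neg_one_le_cos δ]
  have hcosδ : Real.cos δ < 1 := by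
    have := Real.cos_lt_cos_of_nonneg_of_le_pi le_rfl (by linarith [hδle 0, abs_nonneg (k₀ 0)]) hδpos
    rwa [Real.cos_zero] at this
  -- the far sup `S_N` is eventually small
  set L : ℝ := ∫ k, |h k| ∂μ + |h k₀| * μ.real Set.univ + 1 with hL
  have hnn : 0 ≤ ∫ k, |h k| ∂μ := integral_nonneg fun k => abs_nonneg _
  have hL0 : 0 < L := by
    have h2 : 0 ≤ |h k₀| * μ.real Set.univ := by positivity
    rw [hL]; linarith
  obtain ⟨N₀, hN₀⟩ := Metric.tendsto_atTop.mp (tendsto_vp_far_sup hcosδ) (ε / (2 * L))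
    (div_pos hε (mul_pos two_pos hL0))
  refine ⟨N₀, fun N hN => ?_⟩
  set I : ℝ := ∫ t in (-π)..π, (1 + Real.cos t) ^ N with hI
  have hIpos : 0 < I := vp_integral_pos N
  set S : ℝ := (1 + Real.cos δ) ^ N * 2 ^ N / I ^ 2 with hS
  have hS0 : 0 ≤ S :=
    div_nonneg (mul_nonneg (pow_nonneg hcδ' N) (by positivity)) (by positivity)
  have hSlt : S < ε / (2 * L) := by
    have := hN₀ N hN
    rwa [Real.dist_eq, sub_zero, abs_of_nonneg hS0] at this
  set P : (Fin 2 → ℝ) → ℝ := fun k => (∏ j, (1 + Real.cos (k j - k₀ j)) ^ N) / I ^ 2 with hP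
  have hPnn : ∀ k, 0 ≤ P k := fun k => div_nonneg (Finset.prod_nonneg fun j _ =>
    pow_nonneg (by linarith [Real.neg_one_le_cos (k j - k₀ j)]) N) (by positivity)
  have hPcont : Continuous P := by simp only [hP]; fun_prop
  have hPle : ∀ k, P k ≤ 4 ^ N / I ^ 2 := by
    intro k
    simp only [hP]
    refine div_le_div_of_nonneg_right ?_ (by positivity)
    calc ∏ j, (1 + Real.cos (k j - k₀ j)) ^ N ≤ ∏ _j : Fin 2, (2 : ℝ) ^ N := by
          refine Finset.prod_le_prod (fun j _ => pow_nonneg (by linarith [Real.neg_one_le_cos (k j - k₀ j)]) N)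
            fun j _ => pow_le_pow_left₀ (by linarith [Real.neg_one_le_cos (k j - k₀ j)])
              (by linarith [Real.cos_le_one (k j - k₀ j)]) N
      _ = 4 ^ N := by rw [Fin.prod_univ_two, ← mul_pow]; norm_num
  have hPint : ∫ k, P k ∂μ = 1 := by
    simp only [hP]
    rw [integral_div, hμ, setIntegral_vp_prod N k₀, ← hI, div_self (by positivity)]
  -- far points have a small kernel
  have hPfar : ∀ k ∈ K, δ ≤ dist k k₀ → P k ≤ S := by
    intro k hk hfar
    obtain ⟨j, hj⟩ : ∃ j, δ ≤ |k j - k₀ j| := by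
      by_contra hcon
      push Not at hcon
      have : dist k k₀ < δ := by
        rw [dist_pi_lt_iff hδpos]
        intro j; rw [Real.dist_eq]; exact hcon j
      linarith
    simp only [hP, hS]
    refine div_le_div_of_nonneg_right ?_ (by positivity)
    rw [Fin.prod_univ_two]
    have hkj : ∀ j, |k j| ≤ π := fun j => abs_le.2 (hk j (Set.mem_univ _))
    have hb : ∀ j, (1 + Real.cos (k j - k₀ j)) ^ N ≤ 2 ^ N := fun j =>
      pow_le_pow_left₀ (by linarith [Real.neg_one_le_cos (k j - k₀ j)]) (by linarith [Real.cos_le_one (k j - k₀ j)]) N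
    have hsm : ∀ j, δ ≤ |k j - k₀ j| → (1 + Real.cos (k j - k₀ j)) ^ N ≤ (1 + Real.cos δ) ^ N := fun j hj =>
      pow_le_pow_left₀ (by linarith [Real.neg_one_le_cos (k j - k₀ j)])
        (one_add_cos_sub_le hδpos.le (hkj j) (hδle j) hj) N
    have h0 : 0 ≤ (1 + Real.cos (k 0 - k₀ 0)) ^ N := pow_nonneg (by linarith [Real.neg_one_le_cos (k 0 - k₀ 0)]) N
    have h1 : 0 ≤ (1 + Real.cos (k 1 - k₀ 1)) ^ N := pow_nonneg (by linarith [Real.neg_one_le_cos (k 1 - k₀ 1)]) N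
    obtain hj0 | hj1 := (Fin.exists_fin_two (p := fun j => δ ≤ |k j - k₀ j|)).mp ⟨j, hj⟩
    · exact mul_le_mul (hsm 0 hj0) (hb 1) h1 (pow_nonneg hcδ' N)
    · calc (1 + Real.cos (k 0 - k₀ 0)) ^ N * (1 + Real.cos (k 1 - k₀ 1)) ^ N ≤ 2 ^ N * (1 + Real.cos δ) ^ N :=
          mul_le_mul (hb 0) (hsm 1 hj1) h1 (by positivity)
        _ = (1 + Real.cos δ) ^ N * 2 ^ N := mul_comm _ _
  -- pointwise bound of `(h k - h k₀) P k`
  have hpt : ∀ k ∈ K, |(h k - h k₀) * P k| ≤ (ε / 2) * P k + S * (|h k| + |h k₀|) := by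
    intro k hk
    rw [abs_mul, abs_of_nonneg (hPnn k)]
    by_cases hnear : dist k k₀ < δ
    · have : |h k - h k₀| ≤ ε / 2 := by
        have := hδ₀h (lt_of_lt_of_le hnear (min_le_left _ _)); rw [Real.dist_eq] at this; exact this.le
      have : 0 ≤ S * (|h k| + |h k₀|) := by positivity
      nlinarith [hPnn k]
    · push Not at hnear
      have h1 : P k ≤ S := hPfar k hk hnear
      have h2 : |h k - h k₀| ≤ |h k| + |h k₀| := abs_sub _ _
      have : 0 ≤ (ε / 2) * P k := mul_nonneg (by positivity) (hPnn k)
      calc |h k - h k₀| * P k ≤ (|h k| + |h k₀|) * S :=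
            mul_le_mul h2 h1 (hPnn k) (by positivity)
        _ ≤ (ε / 2) * P k + S * (|h k| + |h k₀|) := by linarith
  -- integrate
  have hI1 : Integrable (fun k => h k * P k) μ :=
    hint.mul_bdd hPcont.aestronglyMeasurable (Eventually.of_forall fun k => by
      rw [Real.norm_eq_abs, abs_of_nonneg (hPnn k)]; exact hPle k)
  have hI2 : Integrable (fun k => h k₀ * P k) μ := (integrableOn_cube_of_continuous hPcont).const_mul _
  have hdiff : (∫ k, h k * P k ∂μ) - h k₀ = ∫ k, (h k - h k₀) * P k ∂μ := by
    have hk₀ : ∫ k, h k₀ * P k ∂μ = h k₀ := by rw [integral_const_mul, hPint, mul_one]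
    calc (∫ k, h k * P k ∂μ) - h k₀ = (∫ k, h k * P k ∂μ) - ∫ k, h k₀ * P k ∂μ := by rw [hk₀]
      _ = ∫ k, (h k * P k - h k₀ * P k) ∂μ := (integral_sub hI1 hI2).symm
      _ = ∫ k, (h k - h k₀) * P k ∂μ := integral_congr_ae (Eventually.of_forall fun k => by ring)
  have hgoal : (∫ k in K, h k * ∏ j, (1 + Real.cos (k j - k₀ j)) ^ N) / I ^ 2 = ∫ k, h k * P k ∂μ := by
    rw [hμ, ← integral_div]
    refine integral_congr_ae (Eventually.of_forall fun k => ?_)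
    simp only [hP]; ring
  rw [Real.dist_eq, hgoal, hdiff]
  have hI3 : Integrable (fun k => (h k - h k₀) * P k) μ := by
    have : (fun k => (h k - h k₀) * P k) = fun k => h k * P k - h k₀ * P k := by funext k; ring
    rw [this]; exact hI1.sub hI2
  have hI4 : Integrable (fun k => (ε / 2) * P k + S * (|h k| + |h k₀|)) μ :=
    ((integrableOn_cube_of_continuous hPcont).const_mul _).add ((hint.abs.add (integrable_const _)).const_mul _)
  calc |∫ k, (h k - h k₀) * P k ∂μ| ≤ ∫ k, |(h k - h k₀) * P k| ∂μ := abs_integral_le_integral_abs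
    _ ≤ ∫ k, ((ε / 2) * P k + S * (|h k| + |h k₀|)) ∂μ := by
        refine integral_mono_ae hI3.abs hI4 ?_
        rw [hμ]
        filter_upwards [ae_restrict_mem hKm] with k hk
        exact hpt k hk
    _ = ε / 2 + S * (∫ k, |h k| ∂μ + |h k₀| * μ.real Set.univ) := by
        have hJ1 : Integrable (fun k => ε / 2 * P k) μ := (integrableOn_cube_of_continuous hPcont).const_mul _
        have hJ3 : Integrable (fun k => |h k|) μ := hint.abs
        have hJ4 : Integrable (fun k => |h k| + |h k₀|) μ := hJ3.add (integrable_const _)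
        have hJ2 : Integrable (fun k => S * (|h k| + |h k₀|)) μ := hJ4.const_mul S
        rw [integral_add hJ1 hJ2, integral_const_mul, hPint, integral_const_mul,
          integral_add hJ3 (integrable_const _), integral_const, smul_eq_mul]
        ring
    _ < ε / 2 + ε / (2 * L) * L := by
        have h1 : ∫ k, |h k| ∂μ + |h k₀| * μ.real Set.univ ≤ L := by rw [hL]; linarith
        have h0 : 0 ≤ ∫ k, |h k| ∂μ + |h k₀| * μ.real Set.univ := by positivity
        have h2 : S * (∫ k, |h k| ∂μ + |h k₀| * μ.real Set.univ) ≤ S * L := mul_le_mul_of_nonneg_left h1 hS0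
        have h3 : S * L < ε / (2 * L) * L := mul_lt_mul_of_pos_right hSlt hL0
        linarith
    _ = ε := by field_simp; ring

/-- **Registered auxiliary stub `stub_pickInversion_auxLocalisation`** (sub-goal of
`stub_pickInversion`): localisation of cube integrals at a point of continuity with the de la
Vallée-Poussin product kernel (`tendsto_setIntegral_vp_kernel`). [folklore] -/
theorem stub_pickInversion_auxLocalisation : ∀ (h : (Fin 2 → ℝ) → ℝ) (k₀ : Fin 2 → ℝ),
    MeasureTheory.IntegrableOn h (Set.pi Set.univ (fun _ : Fin 2 => Set.Icc (-Real.pi) Real.pi)) →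
    (∀ j, |k₀ j| < Real.pi) → ContinuousAt h k₀ →
    Filter.Tendsto (fun N : ℕ => (∫ k in Set.pi Set.univ (fun _ : Fin 2 => Set.Icc (-Real.pi) Real.pi),
        h k * ∏ j, (1 + Real.cos (k j - k₀ j)) ^ N) / (∫ t in (-Real.pi)..Real.pi, (1 + Real.cos t) ^ N) ^ 2)
      Filter.atTop (nhds (h k₀)) :=
  fun _ _ hint hk₀ hcont => tendsto_setIntegral_vp_kernel hint hk₀ hcont

end Summit.CriticalPhenomena.Ising3DConformalLimit.Cruxes.DirectCorrelationStableTail.SelfEnergyPickInversion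

end
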